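import Mathlib.Analysis.Calculus.DifferentialForm.Basic
import Mathlib.MeasureTheory.Integral.DivergenceTheorem
import Mathlib.Analysis.Calculus.ContDiff.RCLike
import HarnessLib

/-!
# Stokes' theorem on a coordinate box for an `n`-form on `ℝⁿ⁺¹`

For a differential `n`-form `η : ℝⁿ⁺¹ → ℝⁿ⁺¹ [⋀^Fin n]→L[ℝ] F` (Mathlib's model of differential forms
on a normed space, `Mathlib/Analysis/Calculus/DifferentialForm/Basic.lean`, with the exterior derivative
`extDeriv`), of class `C¹` on an open neighbourhood of a box `[a, b] ⊆ ℝⁿ⁺¹ = Fin (n + 1) → ℝ`,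

  `∫_{[a,b]} dη(e₀, …, e_n) = ∑ᵢ (-1)ⁱ ( ∫_{xᵢ = bᵢ} η(e₀, …, ê_i, …, e_n) - ∫_{xᵢ = aᵢ} η(e₀, …, ê_i, …, e_n) )`,

the faces being parametrised, as in Mathlib's divergence theorem
(`MeasureTheory.integral_divergence_of_hasFDerivAt_off_countable'`), by the boxes
`[a ∘ Fin.succAbove i, b ∘ Fin.succAbove i] ⊆ ℝⁿ` through `Fin.insertNth i (b i)` (front face) and
`Fin.insertNth i (a i)` (back face).  This is Stokes' theorem for the singular cube `[a, b]`
(Spivak, *Calculus on Manifolds*, Thm. 4-13, for the standard cube) and is obtained from the divergence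
theorem applied to the vector field `fᵢ = (-1)ⁱ η(e ∘ Fin.succAbove i)`, whose divergence is
`dη(e₀, …, e_n)` by Mathlib's normalisation of `extDeriv`
(`dω(x; v₀, …, v_n) = ∑ᵢ (-1)ⁱ D_x ω(x; v₀, …, v̂ᵢ, …, v_n) · vᵢ`, `extDeriv_apply`).

Main statement: `integral_extDeriv_Icc_eq_sum_faces`.  Theorems only (no definitions, no named facts).
It is the analytic input of the cocycle identity for periods of closed forms over cone-cubes /
straight simplices (simplicial de Rham theory, Dupont; Eisenstein cocycles, Sczech).

## References

* M. Spivak, *Calculus on Manifolds*, Benjamin 1965, Thm. 4-13 (Stokes' theorem for chains) and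
  the definition of the boundary of the standard cube before it. [Spivak1965]
* J. L. Dupont, *Simplicial de Rham cohomology and characteristic classes of flat bundles*,
  Topology 15 (1976), 233–245, §1. [Dupont1976]
-/

noncomputable section

open Set MeasureTheory ContinuousAlternatingMap

namespace Literature.Analysis.Calculus

variable {F : Type*} [NormedAddCommGroup F] [NormedSpace ℝ F] {n : ℕ}

/-- The standard basis vector field argument `(e₀, …, e_n)` with the `i`-th vector removed is
`(e_{succAbove i 0}, …)`: `Fin.removeNth` is composition with `Fin.succAbove` (definitional).
[folklore] -/
theorem removeNth_basis (i : Fin (n + 1)) :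
    i.removeNth (fun k : Fin (n + 1) => (Pi.single k (1 : ℝ) : Fin (n + 1) → ℝ)) =
      fun j : Fin n => (Pi.single (i.succAbove j) (1 : ℝ) : Fin (n + 1) → ℝ) :=
  rfl

/-- Derivative of the evaluation `x ↦ η x w` of a differentiable form-valued map at a fixed tuple of
vectors: `D(η · w)(x) h = (Dη(x) h) w`. [folklore] -/
theorem hasFDerivAt_apply_const {E : Type*} [NormedAddCommGroup E] [NormedSpace ℝ E]
    {G : Type*} [NormedAddCommGroup G] [NormedSpace ℝ G] {m : ℕ}
    {η : E → G [⋀^Fin m]→L[ℝ] F} {η' : E →L[ℝ] G [⋀^Fin m]→L[ℝ] F} {x : E}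
    (h : HasFDerivAt η η' x) (w : Fin m → G) :
    HasFDerivAt (fun y => η y w) ((ContinuousAlternatingMap.apply ℝ G F w).comp η') x :=
  (ContinuousAlternatingMap.apply ℝ G F w).hasFDerivAt.comp x h

/-- **The exterior derivative on the coordinate basis is a divergence.**
`dη(x)(e₀, …, e_n) = ∑ᵢ (-1)ⁱ (Dη(x) eᵢ)(e ∘ Fin.succAbove i)` (Mathlib's normalisation of `extDeriv`;
both sides use `fderiv`, so no differentiability hypothesis is needed). [folklore] -/
theorem extDeriv_apply_basis (η : (Fin (n + 1) → ℝ) → (Fin (n + 1) → ℝ) [⋀^Fin n]→L[ℝ] F)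
    (x : Fin (n + 1) → ℝ) :
    extDeriv η x (fun k => Pi.single k 1) =
      ∑ i : Fin (n + 1), (-1 : ℝ) ^ (i : ℕ) •
        fderiv ℝ η x (Pi.single i 1) (fun j => Pi.single (i.succAbove j) 1) := by
  rw [extDeriv, alternatizeUncurryFin_apply]
  refine Finset.sum_congr rfl fun i _ => ?_
  rw [← removeNth_basis i]
  norm_cast

/-- **Stokes' theorem on a box for an `n`-form on `ℝⁿ⁺¹`.**  If `η` is of class `C¹` on an open
set containing the box `[a, b]` (`a ≤ b`), then
`∫_{[a,b]} dη(e₀,…,e_n) = ∑ᵢ (-1)ⁱ (∫_{face i, xᵢ = bᵢ} η(e ∘ succAbove i) - ∫_{face i, xᵢ = aᵢ} η(e ∘ succAbove i))`,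
faces parametrised by `Fin.insertNth i (b i)` / `Fin.insertNth i (a i)` on the box
`[a ∘ succAbove i, b ∘ succAbove i]`, exactly as in Mathlib's divergence theorem, from which it follows
with the vector field `fᵢ = (-1)ⁱ η(e ∘ succAbove i)`. [cite: Spivak1965, Thm. 4-13] -/
theorem integral_extDeriv_Icc_eq_sum_faces [CompleteSpace F] (a b : Fin (n + 1) → ℝ) (hle : a ≤ b)
    (η : (Fin (n + 1) → ℝ) → (Fin (n + 1) → ℝ) [⋀^Fin n]→L[ℝ] F) {U : Set (Fin (n + 1) → ℝ)}
    (hU : IsOpen U) (hsub : Icc a b ⊆ U) (hη : ContDiffOn ℝ 1 η U) :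
    ∫ x in Icc a b, extDeriv η x (fun k => Pi.single k 1) =
      ∑ i : Fin (n + 1), (-1 : ℝ) ^ (i : ℕ) •
        ((∫ y in Icc (a ∘ i.succAbove) (b ∘ i.succAbove),
            η (i.insertNth (b i) y) (fun j => Pi.single (i.succAbove j) 1)) -
          ∫ y in Icc (a ∘ i.succAbove) (b ∘ i.succAbove),
            η (i.insertNth (a i) y) (fun j => Pi.single (i.succAbove j) 1)) := by
  -- the vector field `fᵢ = (-1)ⁱ η(e ∘ succAbove i)` and its derivative
  set v : Fin (n + 1) → Fin n → (Fin (n + 1) → ℝ) :=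
    fun i j => Pi.single (i.succAbove j) 1 with hv
  set f : Fin (n + 1) → (Fin (n + 1) → ℝ) → F := fun i x => (-1 : ℝ) ^ (i : ℕ) • η x (v i) with hf
  set f' : Fin (n + 1) → (Fin (n + 1) → ℝ) → (Fin (n + 1) → ℝ) →L[ℝ] F :=
    fun i x => (-1 : ℝ) ^ (i : ℕ) • ((ContinuousAlternatingMap.apply ℝ _ F (v i)).comp (fderiv ℝ η x))
    with hf'
  have hdiff : ∀ x ∈ U, DifferentiableAt ℝ η x := fun x hx =>
    (hη.differentiableOn one_ne_zero x hx).differentiableAt (hU.mem_nhds hx)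
  have hderiv : ∀ x ∈ U, ∀ i, HasFDerivAt (f i) (f' i x) x := fun x hx i =>
    (hasFDerivAt_apply_const (hdiff x hx).hasFDerivAt (v i)).const_smul _
  -- continuity of `η` and of `Dη` on `U`
  have hcont : ContinuousOn η U := hη.continuousOn
  have hcont' : ContinuousOn (fderiv ℝ η) U := hη.continuousOn_fderiv_of_isOpen hU le_rfl
  -- the divergence is `dη(e₀, …, e_n)`
  have hdiv : ∀ x ∈ U, (∑ i, f' i x (Pi.single i 1)) = extDeriv η x (fun k => Pi.single k 1) := by
    intro x hx
    rw [extDeriv_apply_basis η x]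
    refine Finset.sum_congr rfl fun i _ => ?_
    simp only [hf', _root_.smul_apply, ContinuousLinearMap.comp_apply,
      ContinuousAlternatingMap.apply_apply, hv]
  -- integrability of the divergence: it is continuous on the compact box
  have hint : IntegrableOn (fun x => ∑ i, f' i x (Pi.single i 1)) (Icc a b) := by
    refine ContinuousOn.integrableOn_compact isCompact_Icc ?_
    refine continuousOn_finsetSum _ fun i _ => ?_
    have h1 : ContinuousOn (fun x => fderiv ℝ η x (Pi.single i 1) (v i)) U := by
      have happ : Continuous fun L : (Fin (n + 1) → ℝ) →L[ℝ] (Fin (n + 1) → ℝ) [⋀^Fin n]→L[ℝ] F =>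
          L (Pi.single i 1) (v i) :=
        (ContinuousAlternatingMap.apply ℝ _ F (v i)).continuous.comp
          (continuous_id.clm_apply continuous_const)
      exact happ.comp_continuousOn hcont'
    refine ((h1.mono hsub).const_smul ((-1 : ℝ) ^ (i : ℕ))).congr fun x _ => ?_
    simp only [hf', _root_.smul_apply, ContinuousLinearMap.comp_apply,
      ContinuousAlternatingMap.apply_apply, Pi.smul_apply]
  have hfc : ∀ i, ContinuousOn (f i) (Icc a b) := fun i =>
    ((ContinuousAlternatingMap.apply ℝ _ F (v i)).continuous.comp_continuousOn
      (hcont.mono hsub)).const_smul _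
  have hIoo : (Set.pi univ fun i => Ioo (a i) (b i)) ⊆ Icc a b := by
    rw [← Set.pi_univ_Icc]
    exact Set.pi_mono fun i _ => Ioo_subset_Icc_self
  have hmain := integral_divergence_of_hasFDerivAt_off_countable' a b hle f f' ∅ countable_empty
    hfc (fun x hx i => hderiv x (hsub (hIoo hx.1)) i) hint
  rw [setIntegral_congr_fun measurableSet_Icc (fun x hx => hdiv x (hsub hx))] at hmain
  rw [hmain]
  refine Finset.sum_congr rfl fun i _ => ?_
  simp only [hf, hv]
  rw [integral_smul, integral_smul, smul_sub]

/-- **Stokes' theorem on a box for an `n`-form on `ℝⁿ⁺¹`, minimal regularity**: it suffices that `η`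
be differentiable on an open set containing the box `[a, b]` and that `x ↦ dη(x)(e₀, …, e_n)` be
integrable on the box (for instance because it vanishes there — the case of a pulled-back closed
form).  Same conclusion and same parametrisation of the faces as
`integral_extDeriv_Icc_eq_sum_faces`. [cite: Spivak1965, Thm. 4-13] -/
theorem integral_extDeriv_Icc_eq_sum_faces_of_differentiableOn [CompleteSpace F]
    (a b : Fin (n + 1) → ℝ) (hle : a ≤ b)
    (η : (Fin (n + 1) → ℝ) → (Fin (n + 1) → ℝ) [⋀^Fin n]→L[ℝ] F) {U : Set (Fin (n + 1) → ℝ)}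
    (hU : IsOpen U) (hsub : Icc a b ⊆ U) (hη : DifferentiableOn ℝ η U)
    (hint : IntegrableOn (fun x => extDeriv η x (fun k => Pi.single k 1)) (Icc a b)) :
    ∫ x in Icc a b, extDeriv η x (fun k => Pi.single k 1) =
      ∑ i : Fin (n + 1), (-1 : ℝ) ^ (i : ℕ) •
        ((∫ y in Icc (a ∘ i.succAbove) (b ∘ i.succAbove),
            η (i.insertNth (b i) y) (fun j => Pi.single (i.succAbove j) 1)) -
          ∫ y in Icc (a ∘ i.succAbove) (b ∘ i.succAbove),
            η (i.insertNth (a i) y) (fun j => Pi.single (i.succAbove j) 1)) := by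
  -- the vector field `fᵢ = (-1)ⁱ η(e ∘ succAbove i)` and its derivative
  set v : Fin (n + 1) → Fin n → (Fin (n + 1) → ℝ) :=
    fun i j => Pi.single (i.succAbove j) 1 with hv
  set f : Fin (n + 1) → (Fin (n + 1) → ℝ) → F := fun i x => (-1 : ℝ) ^ (i : ℕ) • η x (v i) with hf
  set f' : Fin (n + 1) → (Fin (n + 1) → ℝ) → (Fin (n + 1) → ℝ) →L[ℝ] F :=
    fun i x => (-1 : ℝ) ^ (i : ℕ) • ((ContinuousAlternatingMap.apply ℝ _ F (v i)).comp (fderiv ℝ η x))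
    with hf'
  have hdiff : ∀ x ∈ U, DifferentiableAt ℝ η x := fun x hx =>
    (hη x hx).differentiableAt (hU.mem_nhds hx)
  have hderiv : ∀ x ∈ U, ∀ i, HasFDerivAt (f i) (f' i x) x := fun x hx i =>
    (hasFDerivAt_apply_const (hdiff x hx).hasFDerivAt (v i)).const_smul _
  have hcont : ContinuousOn η U := hη.continuousOn
  -- the divergence is `dη(e₀, …, e_n)`
  have hdiv : ∀ x, (∑ i, f' i x (Pi.single i 1)) = extDeriv η x (fun k => Pi.single k 1) := by
    intro x
    rw [extDeriv_apply_basis η x]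
    refine Finset.sum_congr rfl fun i _ => ?_
    simp only [hf', _root_.smul_apply, ContinuousLinearMap.comp_apply,
      ContinuousAlternatingMap.apply_apply, hv]
  have hint' : IntegrableOn (fun x => ∑ i, f' i x (Pi.single i 1)) (Icc a b) :=
    hint.congr_fun (fun x _ => (hdiv x).symm) measurableSet_Icc
  have hfc : ∀ i, ContinuousOn (f i) (Icc a b) := fun i =>
    ((ContinuousAlternatingMap.apply ℝ _ F (v i)).continuous.comp_continuousOn
      (hcont.mono hsub)).const_smul _
  have hIoo : (Set.pi univ fun i => Ioo (a i) (b i)) ⊆ Icc a b := by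
    rw [← Set.pi_univ_Icc]
    exact Set.pi_mono fun i _ => Ioo_subset_Icc_self
  have hmain := integral_divergence_of_hasFDerivAt_off_countable' a b hle f f' ∅ countable_empty
    hfc (fun x hx i => hderiv x (hsub (hIoo hx.1)) i) hint'
  rw [setIntegral_congr_fun measurableSet_Icc (fun x _ => hdiv x)] at hmain
  rw [hmain]
  refine Finset.sum_congr rfl fun i _ => ?_
  simp only [hf, hv]
  rw [integral_smul, integral_smul, smul_sub]

end Literature.Analysis.Calculus

end
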